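import Summits.CriticalPhenomena.PercolationContinuityZ3.Theorems.PercNearOneGluingNoHeavyLowerTailAntipodalR1TwoCutComponents
import Summits.CriticalPhenomena.PercolationContinuityZ3.Theorems.PercNearOneGluingNoHeavyLowerTailAntipodalR1OneSumApex
import HarnessLib

/-!
# ANTI₁ across a cut vertex, graded: the grade shift of a 1-sum

Support file for `stmt-CriticalPhenomena-4575` (memo `prim-gen-kcluster/KCLUSTER-gen73.md` §1.8, graded;
conjecture ANTI₁-GRADED of `KCLUSTER-gen52.md` §3).  No definitions, no named facts, no sorries.
Vocabulary of `AntipodalR1` (gen 62); the abstract component count `card_cc_add_card_eq` (part VI) and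
the cut-vertex cluster lemma `mem_clus_iff_of_cutVertex` (`…OneSumApex`) of gen 78.

For `G = A ∪ T` glued at the single vertex `u` (`Sum.elim endsA endsT`, every vertex met by edges of both
sides equal to `u`) and every colouring `ω = ω_A ⊕ ω_T`:
* `card_cc_cutVertex_add_eq` — per colour, `#CC_col(G, ω) + #I_T = #CC_col(A, ω_A) + c^T_col(ω_T)`, where
  `I_T` is the set of vertices met by an edge of `T` and different from `u`, and `c^T_col(ω_T)` is the
  number of `col`-clusters of `T` (on the whole vertex type) made of such vertices;
* `grade_cutVertex_eq` — hence `g_G(ω) + 2·#I_T = g_A(ω_A) + c^T(ω_T)` with `c^T = c^T_true + c^T_false`;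
* `card_ccInsideT_flip_add` — `c^T(ω̄_T) = c^T(ω_T)`;
* `colGraph_swap_eq`, `grade_cutVertex_eq'` — the mirror identity `g_G(ω) + 2·#I_A = g_T(ω_T) + c^A(ω_A)`
  (the coloured graphs do not depend on the order of the two summands).
These are the grade bookkeeping facts for the graded 1-sum reductions (B), (C), (D) (sequel files).
[this work]
-/

namespace Summit.CriticalPhenomena.PercolationContinuityZ3.Theorems

namespace AntipodalR1

open Finset Relation SimpleGraph

variable {V ιA ιT : Type*}

section CutVertex

variable {endsA : ιA → Sym2 V} {endsT : ιT → Sym2 V} {u : V}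

/-- The coloured graphs of a glued system do not depend on the order of the summands. [this work] -/
theorem colGraph_swap_eq (ω : ιA ⊕ ιT → Bool) (col : Bool) :
    fromEdgeSet {s : Sym2 V | ∃ e, (fun e => ω (Sum.swap e)) e = col ∧ Sum.elim endsT endsA e = s} =
      fromEdgeSet {s : Sym2 V | ∃ e, ω e = col ∧ Sum.elim endsA endsT e = s} := by
  congr 1
  ext s
  simp only [Set.mem_setOf_eq]
  constructor
  · rintro ⟨e, he, hends⟩
    cases e with
    | inl j => exact ⟨Sum.inr j, he, hends⟩
    | inr i => exact ⟨Sum.inl i, he, hends⟩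
  · rintro ⟨e, he, hends⟩
    cases e with
    | inl i => exact ⟨Sum.inr i, he, hends⟩
    | inr j => exact ⟨Sum.inl j, he, hends⟩

variable [Finite V]

/-- **Component count across a cut vertex.**  Per colour:
`#CC_col(A ∪_u T, ω) + #I_T = #CC_col(A, ω_A) + c^T_col(ω_T)`. [this work] -/
theorem card_cc_cutVertex_add_eq
    (hsep : ∀ w i, w ∈ endsA i → ∀ j, w ∈ endsT j → w = u) (ω : ιA ⊕ ιT → Bool) (col : Bool) :
    Nat.card (fromEdgeSet {s : Sym2 V | ∃ e, ω e = col ∧ Sum.elim endsA endsT e = s}).ConnectedComponent +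
      Nat.card {w : V | ¬ ∀ j, w ∈ endsT j → w = u} =
    Nat.card (fromEdgeSet {s : Sym2 V | ∃ i, ω (Sum.inl i) = col ∧ endsA i = s}).ConnectedComponent +
      Nat.card {D : (fromEdgeSet {s : Sym2 V | ∃ j, ω (Sum.inr j) = col ∧ endsT j = s}).ConnectedComponent //
        ¬ ∃ x, x ∉ {w : V | ¬ ∀ j, w ∈ endsT j → w = u} ∧
          (fromEdgeSet {s : Sym2 V | ∃ j, ω (Sum.inr j) = col ∧ endsT j = s}).connectedComponentMk x = D} := by
  refine card_cc_add_card_eq _ _ _ _ ?_ ?_ ?_ ?_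
  · intro x y hx hy
    simp only [Set.mem_setOf_eq, not_not] at hx hy
    rw [reachable_iff_mem_clus, reachable_iff_mem_clus]
    exact mem_clus_iff_of_cutVertex hsep hx hy
  · intro w hw z h
    simp only [Set.mem_setOf_eq] at hw
    rw [fromEdgeSet_adj] at h
    obtain ⟨⟨i, -, hends⟩, -⟩ := h
    exact hw fun j hj => hsep w i (by rw [hends]; exact Sym2.mem_mk_left _ _) j hj
  · exact fromEdgeSet_mono fun s ⟨j, hj, hends⟩ => ⟨Sum.inr j, hj, hends⟩
  · intro w hw z h
    simp only [Set.mem_setOf_eq] at hw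
    rw [fromEdgeSet_adj] at h ⊢
    obtain ⟨⟨e, he, hends⟩, hne⟩ := h
    cases e with
    | inl i =>
      have hwi : w ∈ endsA i := by
        rw [show endsA i = s(w, z) from hends]; exact Sym2.mem_mk_left _ _
      exact (hw fun j hj => hsep w i hwi j hj).elim
    | inr j => exact ⟨⟨j, he, hends⟩, hne⟩

/-- **Grade shift across a cut vertex.**  `g_G(ω_A ⊕ ω_T) + 2·#I_T = g_A(ω_A) + c^T(ω_T)`. [this work] -/
theorem grade_cutVertex_eq
    (hsep : ∀ w i, w ∈ endsA i → ∀ j, w ∈ endsT j → w = u) (ωA : ιA → Bool) (ωT : ιT → Bool) :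
    (Nat.card (fromEdgeSet {s : Sym2 V | ∃ e, Sum.elim ωA ωT e = true ∧
        Sum.elim endsA endsT e = s}).ConnectedComponent +
      Nat.card (fromEdgeSet {s : Sym2 V | ∃ e, Sum.elim ωA ωT e = false ∧
        Sum.elim endsA endsT e = s}).ConnectedComponent) +
      2 * Nat.card {w : V | ¬ ∀ j, w ∈ endsT j → w = u} =
    (Nat.card (fromEdgeSet {s : Sym2 V | ∃ i, ωA i = true ∧ endsA i = s}).ConnectedComponent +
      Nat.card (fromEdgeSet {s : Sym2 V | ∃ i, ωA i = false ∧ endsA i = s}).ConnectedComponent) +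
      (Nat.card {D : (fromEdgeSet {s : Sym2 V | ∃ j, ωT j = true ∧ endsT j = s}).ConnectedComponent //
          ¬ ∃ x, x ∉ {w : V | ¬ ∀ j, w ∈ endsT j → w = u} ∧
            (fromEdgeSet {s : Sym2 V | ∃ j, ωT j = true ∧ endsT j = s}).connectedComponentMk x = D} +
        Nat.card {D : (fromEdgeSet {s : Sym2 V | ∃ j, ωT j = false ∧ endsT j = s}).ConnectedComponent //
          ¬ ∃ x, x ∉ {w : V | ¬ ∀ j, w ∈ endsT j → w = u} ∧
            (fromEdgeSet {s : Sym2 V | ∃ j, ωT j = false ∧ endsT j = s}).connectedComponentMk x = D}) := by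
  have h1 := card_cc_cutVertex_add_eq hsep (Sum.elim ωA ωT) true
  have h2 := card_cc_cutVertex_add_eq hsep (Sum.elim ωA ωT) false
  simp only [Sum.elim_inl, Sum.elim_inr] at h1 h2
  omega

omit [Finite V] in
/-- **Swap invariance of `c^T`.**  `c^T(ω̄_T) = c^T(ω_T)` (as a sum over the two colours). [this work] -/
theorem card_ccInsideT_flip_add (ωT : ιT → Bool) :
    Nat.card {D : (fromEdgeSet {s : Sym2 V | ∃ j, (!ωT j) = true ∧ endsT j = s}).ConnectedComponent //
        ¬ ∃ x, x ∉ {w : V | ¬ ∀ j, w ∈ endsT j → w = u} ∧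
          (fromEdgeSet {s : Sym2 V | ∃ j, (!ωT j) = true ∧ endsT j = s}).connectedComponentMk x = D} +
      Nat.card {D : (fromEdgeSet {s : Sym2 V | ∃ j, (!ωT j) = false ∧ endsT j = s}).ConnectedComponent //
        ¬ ∃ x, x ∉ {w : V | ¬ ∀ j, w ∈ endsT j → w = u} ∧
          (fromEdgeSet {s : Sym2 V | ∃ j, (!ωT j) = false ∧ endsT j = s}).connectedComponentMk x = D} =
    Nat.card {D : (fromEdgeSet {s : Sym2 V | ∃ j, ωT j = true ∧ endsT j = s}).ConnectedComponent //
        ¬ ∃ x, x ∉ {w : V | ¬ ∀ j, w ∈ endsT j → w = u} ∧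
          (fromEdgeSet {s : Sym2 V | ∃ j, ωT j = true ∧ endsT j = s}).connectedComponentMk x = D} +
      Nat.card {D : (fromEdgeSet {s : Sym2 V | ∃ j, ωT j = false ∧ endsT j = s}).ConnectedComponent //
        ¬ ∃ x, x ∉ {w : V | ¬ ∀ j, w ∈ endsT j → w = u} ∧
          (fromEdgeSet {s : Sym2 V | ∃ j, ωT j = false ∧ endsT j = s}).connectedComponentMk x = D} := by
  have hT : (fromEdgeSet {s : Sym2 V | ∃ j, (!ωT j) = true ∧ endsT j = s}) =
      fromEdgeSet {s : Sym2 V | ∃ j, ωT j = false ∧ endsT j = s} := by simp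
  have hF : (fromEdgeSet {s : Sym2 V | ∃ j, (!ωT j) = false ∧ endsT j = s}) =
      fromEdgeSet {s : Sym2 V | ∃ j, ωT j = true ∧ endsT j = s} := by simp
  rw [hT, hF, Nat.add_comm]

/-- **Mirror grade shift.**  `g_G(ω_A ⊕ ω_T) + 2·#I_A = g_T(ω_T) + c^A(ω_A)`, with `I_A` the vertices
met by an edge of `A` other than `u`. [this work] -/
theorem grade_cutVertex_eq'
    (hsep : ∀ w i, w ∈ endsA i → ∀ j, w ∈ endsT j → w = u) (ωA : ιA → Bool) (ωT : ιT → Bool) :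
    (Nat.card (fromEdgeSet {s : Sym2 V | ∃ e, Sum.elim ωA ωT e = true ∧
        Sum.elim endsA endsT e = s}).ConnectedComponent +
      Nat.card (fromEdgeSet {s : Sym2 V | ∃ e, Sum.elim ωA ωT e = false ∧
        Sum.elim endsA endsT e = s}).ConnectedComponent) +
      2 * Nat.card {w : V | ¬ ∀ i, w ∈ endsA i → w = u} =
    (Nat.card (fromEdgeSet {s : Sym2 V | ∃ j, ωT j = true ∧ endsT j = s}).ConnectedComponent +
      Nat.card (fromEdgeSet {s : Sym2 V | ∃ j, ωT j = false ∧ endsT j = s}).ConnectedComponent) +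
      (Nat.card {D : (fromEdgeSet {s : Sym2 V | ∃ i, ωA i = true ∧ endsA i = s}).ConnectedComponent //
          ¬ ∃ x, x ∉ {w : V | ¬ ∀ i, w ∈ endsA i → w = u} ∧
            (fromEdgeSet {s : Sym2 V | ∃ i, ωA i = true ∧ endsA i = s}).connectedComponentMk x = D} +
        Nat.card {D : (fromEdgeSet {s : Sym2 V | ∃ i, ωA i = false ∧ endsA i = s}).ConnectedComponent //
          ¬ ∃ x, x ∉ {w : V | ¬ ∀ i, w ∈ endsA i → w = u} ∧
            (fromEdgeSet {s : Sym2 V | ∃ i, ωA i = false ∧ endsA i = s}).connectedComponentMk x = D}) := by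
  have hsep' : ∀ w j, w ∈ endsT j → ∀ i, w ∈ endsA i → w = u :=
    fun w j hj i hi => hsep w i hi j hj
  have h1 := card_cc_cutVertex_add_eq hsep' (fun e => Sum.elim ωA ωT (Sum.swap e)) true
  have h2 := card_cc_cutVertex_add_eq hsep' (fun e => Sum.elim ωA ωT (Sum.swap e)) false
  rw [colGraph_swap_eq (endsA := endsA) (endsT := endsT) (Sum.elim ωA ωT) true] at h1
  rw [colGraph_swap_eq (endsA := endsA) (endsT := endsT) (Sum.elim ωA ωT) false] at h2
  simp only [Sum.swap_inl, Sum.swap_inr, Sum.elim_inl, Sum.elim_inr] at h1 h2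
  omega

end CutVertex

end AntipodalR1

end Summit.CriticalPhenomena.PercolationContinuityZ3.Theorems
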